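import Summits.QuantumFields.YangMills.Theorems.UnitScaleTiltProp7NSOfParallelTopMean
import Summits.QuantumFields.YangMills.Theorems.UnitScaleTiltProp7QTwSCentralTowerRows
import Summits.QuantumFields.YangMills.Theorems.UnitScaleTiltProp7CornerFrameLegsLetters
import Literature.MathematicalPhysics.QuantumFieldTheory.Balaban1983to89.T4Covariance
import HarnessLib

/-!
# NEG-hPcol piece (N4, generic core): **THE DELOCALISED LOW MODE OF A ONE-BLOCK-PERIODIC BACKGROUND WITH TRIVIAL AVERAGED TOWER IS THE CONSTANT ITSELF**
# — `toL2S (fun _ => c) ∈ N_S(U₀)` with the covariant gradient `‖(D_{U₀} c)(b)‖ ≤ 2·δ·L^{K−n}·‖c‖` when the bonds of `U₀` are `δ`-close to `1`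

Cell `ym3-torus` (YM ladder rung R3 = continuum SU(2) Yang–Mills on T³ — a RUNG, NOT d = 4, NOT infinite volume, NOT a mass gap, NOT the Clay
problem), width seat `ym3-torus-px13` (gen 10), crux of record `MinimiserStabilityRegPr` (stmt-QuantumFields-19200, route `UnitScaleTilt`).
★★OWNER WORD 38 (2026-08-29T18:26Z) «NEG-hPcol — GO»: a kernel certificate that the S42ᴸ display row `hPcol` (pre-`Lift` text, ✓p729698) is NOT
inhabitable on px12 g11's explicit stratum-(c) family `U_s` (LOCATE v2.1 8aced68d); px12 g11's NAMING LINE (18:30:32Z ∕ 18:41:38Z) cut it into pieces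
N1–N6 (module token `Neg`, ★★OWNER ACK 108).  THIS FILE is the GENERIC CORE of piece **(N4) «the low mode»** (px13 g10 LOCATE 18:45Z «λ_c ≡ c»):
for ANY printed-regular background `U₀` whose level-0 transports read from block centres do not depend on the block (`hper` — one-block periodicity)
and whose averaged tower is trivial from level 1 on (`htriv : Ū₀ʲ ≡ 1, 1 ≤ j` — piece N3b on the family), the CONSTANT gauge parameter `λ ≡ c`
lies in the residual gauge algebra `N_S(U₀) = ker(Q(U₀)∘D_{U₀})` (§2), and its covariant gradient is bondwise `≤ η⁻¹·2‖U₀(b) − 1‖·‖c‖` (§3).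
No preimage ∕ right inverse of the top nested mean and no tower-closeness estimate is needed: the level-1 nested covariant mean of a constant is a
constant (`c₁`, not `c`) by `hper`, the higher means copy it by `htriv`, and ✓`Prop7NSOfParallelTopMean.mem_NS_of_topMean_parallel` asks only the
bondwise row `Ad_{Ū₀(e)} ns_{K−n}(e₊) = ns_{K−n}(e₋)`, which at `Ū₀ ≡ 1` is `c₁ = c₁`.

WHAT IS PROVED (def-free; member `F`, `h : n ≤ K`, weights `c₀ > 0`, `cB`; ns `…Theorems.Prop7HPcolNegConstantMode`):
* §1 `holT_add_eq_of_translate_eq` (a translation-invariant configuration has translation-invariant transports), ★ `holT_emb_eq_of_blockPeriodic`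
  (ONE-BLOCK PERIODICITY `U.translate (scale a) = U` ⇒ transports read from block centres do not depend on the block — the sufficient condition for `hper`).
* §2 `avgSeq_const_succ` (the explicit averaging sequence `ns 0 = c`, `ns (j+1) = c₁` of the constant satisfies the `hsucc` recursion of
  ✓`QTwS_gaugeDir_of_avgSeq` under `hper`∕`htriv`), ★★★ `toL2S_const_mem_NS` (`RegPr ε₀ U₀`, `10¹²L³ε₀ ≤ 1`, `hper`, `htriv`, `n < K` ⟹
  `toL2S (fun _ => c) ∈ N_S(U₀)` for EVERY `c : M₂(ℂ)`).
* §3 `norm_conjR_bgUnits_sub_le` (`‖U c U⁻¹ − c‖ ≤ 2‖U − 1‖‖c‖` at a bond of an `SU(2)` background), ★★ `norm_toL2_symm_DL2_toL2S_const_le`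
  (`‖((toL2)⁻¹ (D_{U₀} (toL2S c))) b‖ ≤ 2·‖U₀(b) − 1‖·L^{K−n}·‖c‖`), ★★★ `lowMode_const` — the three rows of px12 g11's SPEC-0 `spec_lowMode` with
  `lam := fun _ => c`, `C₁ = 0`, `C₂ = 2δ` under a bond window `‖U₀(b) − 1‖ ≤ δ` (the member instance for `U_s`: `δ = s` by px6 g11's (N2a)
  ✓`norm_exp_I_smul_pauli_sub_one_le`, `hper` by §1 from `L`-periodicity, `htriv` = N3b, `hreg` = N3c — piece N4 proper, px12 g11's file).

HONEST FRAMING.  Linear algebra ∕ bookkeeping over landed letters; `hPcol` is a display BINDER — NEG-hPcol is negative knowledge of record for TARGET.md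
footnote 17v, NOT an item refutation, NOT a display event, NOT progress on EX; nothing of EX ∕ the 13 print rows ∕ `hThm2S` ∕ 19200 ∕ any crux or
rung statement is proved here; the Yang–Mills mass gap is NOT proved.

References: T. Bałaban, CMP **99** (1985) 389–434 [Balaban1985BackgroundPropagators] ((3.3) p.391, (3.19)–(3.21) pp.393–394, (3.114)–(3.115) p.418);
CMP **98** (1985) 17–51 [Balaban1985Averaging] ((9) p.18, (19) p.21); CMP **109** (1987) 249–301 [Balaban1987RG1] ((0.1)–(0.4) pp.251–253).
-/

set_option autoImplicit false

noncomputable section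

open scoped BigOperators Matrix.Norms.L2Operator

namespace Summit.QuantumFields.YangMills.Theorems.Prop7HPcolNegConstantMode

open NormedSpace
open Literature.MathematicalPhysics.QuantumFieldTheory.Balaban1983to89
open Literature.MathematicalPhysics.QuantumFieldTheory.Balaban1983to89.T3ContinuumYM3Torus
open T4Continuum BlockAveraging ExpMeanLog MatrixLog
open BlockAveraging (Idx)
open B7Prop1Explicit (U1 mem_U1 disp)
open B7Eq78Linearization (conjR conjR_apply)
open B8Ineq132 (one_conjR)
open B10Eq27TorusAxialLog (holT holT_nil holT_cons_true holT_cons_false holT_one transl toUField unitsField)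
open B7TransferAnalyticMean (meanCLM)
open Summit.QuantumFields.YangMills.Theorems.Prop8Chart (emlIterU emlIterU_zero)
open T3PrintedRegularMinimiser (RegPr)
open T3SectALandauChart (bgUnits eta eta_pos)
open Summit.QuantumFields.YangMills.Theorems.Prop7SectET3HilbertLetters (toL2 toL2S DL2)
open Summit.QuantumFields.YangMills.Theorems.Prop7SectET3GaugeProjector (NS)
open Summit.QuantumFields.YangMills.Theorems.Prop7NestedMeanParallelLift (toL2_symm_DL2_toL2S_eq)
open Summit.QuantumFields.YangMills.Theorems.Prop7NSOfParallelTopMean (mem_NS_of_topMean_parallel)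
open Summit.QuantumFields.YangMills.Theorems.Prop7SymAvgTwSym (unitsField_toUField_mem_U1')
open Summit.QuantumFields.YangMills.Theorems.Prop7CornerFrameLegsLetters (norm_conjR_sub_conjR_le)

/-! ## §1 One-block periodicity ⇒ transports read from block centres do not depend on the block -/

section Periodic

variable {P : Params} {j : ℕ} {G : Type*} [Group G]

/-- A translation-invariant configuration (`τ_a V = V`) has translation-invariant transports: `V(Γ from x + a) = V(Γ from x)` for every word `Γ`.
[cite: Balaban1985Averaging, (9) p.18] -/
theorem holT_add_eq_of_translate_eq {V : GaugeField P j G} {a : Site P j} (hV : V.translate a = V) :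
    ∀ (x : Site P j) (w : List (B7Prop1Explicit.Letter P.d)), holT V (x + a) w = holT V x w
  | x, [] => by rw [holT_nil, holT_nil]
  | x, (μ, true) :: w => by
    have hb : V ⟨x + a, μ⟩ = V ⟨x, μ⟩ := by
      have := congrArg (fun W => W ⟨x, μ⟩) hV
      simpa only [GaugeField.translate_apply, PBond.translate] using this
    rw [holT_cons_true, holT_cons_true, Site.shift_add, holT_add_eq_of_translate_eq hV (x.shift μ) w, hb]
  | x, (μ, false) :: w => by
    have hb : V ⟨(x + a).unshift μ, μ⟩ = V ⟨x.unshift μ, μ⟩ := by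
      have := congrArg (fun W => W ⟨x.unshift μ, μ⟩) hV
      simpa only [GaugeField.translate_apply, PBond.translate, Site.unshift_add] using this
    rw [holT_cons_false, holT_cons_false, hb, Site.unshift_add, holT_add_eq_of_translate_eq hV (x.unshift μ) w]

/-- ★ **ONE-BLOCK PERIODICITY ⇒ CENTRE-BASED TRANSPORTS ARE BLOCK-INDEPENDENT**: if `τ_{L·a} V = V` for every coarse vector `a` (the configuration is
periodic with period ONE block side in every direction), then `V(Γ from emb y) = V(Γ from emb y₀)` for all blocks `y, y₀` and every word `Γ`
(`emb (y₀ + a) = emb y₀ + L·a`, ✓`Site.emb_add`). [cite: Balaban1987RG1, (0.1) p.251; Balaban1985Averaging, (9) p.18] -/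
theorem holT_emb_eq_of_blockPeriodic {V : GaugeField P j G} (hV : ∀ a : Site P (j + 1), V.translate (Site.scale a) = V)
    (y y₀ : Site P (j + 1)) (w : List (B7Prop1Explicit.Letter P.d)) : holT V (emb y) w = holT V (emb y₀) w := by
  have hy : y = y₀ + (y - y₀) := by abel
  rw [hy, Site.emb_add]
  exact holT_add_eq_of_translate_eq (hV (y - y₀)) (emb y₀) w

end Periodic

/-! ## §2 The constant parameter lies in `N_S(U₀)` -/

section Member

variable (F : T3Family) {n K : ℕ}

/-- The EXPLICIT averaging sequence of the constant parameter `λ ≡ c`: `ns 0 ≡ c`, `ns (j+1) ≡ c₁ := c − mean_i (c − h_i c h_i⁻¹)`, `h_i` the level-0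
staircase transports read from ONE block centre `emb y₀` — it satisfies the `hsucc` recursion of ✓`QTwS_gaugeDir_of_avgSeq` when the level-0 centre-based
transports do not depend on the block (`hper`) and the averaged tower is trivial from level 1 on (`htriv`). [cite: Balaban1985BackgroundPropagators, (3.19) p.393] -/
theorem avgSeq_const_succ (U₀ : GaugeField (F.P K) 0 (Matrix.specialUnitaryGroup (Fin 2) ℂ)) (y₀ : Site (F.P K) 1)
    (hper : ∀ (y : Site (F.P K) 1) (w : List (B7Prop1Explicit.Letter (F.P K).d)), holT (bgUnits F K U₀) (emb y) w = holT (bgUnits F K U₀) (emb y₀) w)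
    (htriv : ∀ j : ℕ, 1 ≤ j → emlIterU j (bgUnits F K U₀) = fun _ => 1) (c : Matrix (Fin 2) (Fin 2) ℂ) (j : ℕ) (y : Site (F.P K) (j + 1)) :
    (fun (j : ℕ) (_ : Site (F.P K) j) => if j = 0 then c else
        c - meanCLM (Idx (F.P K)) (Matrix (Fin 2) (Fin 2) ℂ) fun i : Idx (F.P K) =>
          c - ((holT (bgUnits F K U₀) (emb y₀) (stairWord i.2.1 (off i.1)) : (Matrix (Fin 2) (Fin 2) ℂ)ˣ) : Matrix (Fin 2) (Fin 2) ℂ) * c *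
            (((holT (bgUnits F K U₀) (emb y₀) (stairWord i.2.1 (off i.1)))⁻¹ : (Matrix (Fin 2) (Fin 2) ℂ)ˣ) : Matrix (Fin 2) (Fin 2) ℂ)) (j + 1) y =
      (fun (j : ℕ) (_ : Site (F.P K) j) => if j = 0 then c else
        c - meanCLM (Idx (F.P K)) (Matrix (Fin 2) (Fin 2) ℂ) fun i : Idx (F.P K) =>
          c - ((holT (bgUnits F K U₀) (emb y₀) (stairWord i.2.1 (off i.1)) : (Matrix (Fin 2) (Fin 2) ℂ)ˣ) : Matrix (Fin 2) (Fin 2) ℂ) * c *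
            (((holT (bgUnits F K U₀) (emb y₀) (stairWord i.2.1 (off i.1)))⁻¹ : (Matrix (Fin 2) (Fin 2) ℂ)ˣ) : Matrix (Fin 2) (Fin 2) ℂ)) j (emb y) -
        meanCLM (Idx (F.P K)) (Matrix (Fin 2) (Fin 2) ℂ) fun i : Idx (F.P K) =>
          (fun (j : ℕ) (_ : Site (F.P K) j) => if j = 0 then c else
            c - meanCLM (Idx (F.P K)) (Matrix (Fin 2) (Fin 2) ℂ) fun i : Idx (F.P K) =>
              c - ((holT (bgUnits F K U₀) (emb y₀) (stairWord i.2.1 (off i.1)) : (Matrix (Fin 2) (Fin 2) ℂ)ˣ) : Matrix (Fin 2) (Fin 2) ℂ) * c *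
                (((holT (bgUnits F K U₀) (emb y₀) (stairWord i.2.1 (off i.1)))⁻¹ : (Matrix (Fin 2) (Fin 2) ℂ)ˣ) : Matrix (Fin 2) (Fin 2) ℂ)) j (emb y) -
          ((holT (emlIterU j (bgUnits F K U₀)) (emb y) (stairWord i.2.1 (off i.1)) : (Matrix (Fin 2) (Fin 2) ℂ)ˣ) : Matrix (Fin 2) (Fin 2) ℂ) *
          (fun (j : ℕ) (_ : Site (F.P K) j) => if j = 0 then c else
            c - meanCLM (Idx (F.P K)) (Matrix (Fin 2) (Fin 2) ℂ) fun i : Idx (F.P K) =>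
              c - ((holT (bgUnits F K U₀) (emb y₀) (stairWord i.2.1 (off i.1)) : (Matrix (Fin 2) (Fin 2) ℂ)ˣ) : Matrix (Fin 2) (Fin 2) ℂ) * c *
                (((holT (bgUnits F K U₀) (emb y₀) (stairWord i.2.1 (off i.1)))⁻¹ : (Matrix (Fin 2) (Fin 2) ℂ)ˣ) : Matrix (Fin 2) (Fin 2) ℂ)) j
              (transl (emb y) (disp (stairWord i.2.1 (off i.1)))) *
          (((holT (emlIterU j (bgUnits F K U₀)) (emb y) (stairWord i.2.1 (off i.1)))⁻¹ : (Matrix (Fin 2) (Fin 2) ℂ)ˣ) : Matrix (Fin 2) (Fin 2) ℂ) := by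
  have h0 : (fun _ : Idx (F.P K) => (0 : Matrix (Fin 2) (Fin 2) ℂ)) = 0 := rfl
  rcases j with _ | j
  · -- level `0 → 1`: the centre-based transports are those read from `emb y₀`
    simp only [Nat.zero_add, one_ne_zero, if_false, if_true, emlIterU_zero, hper y]
  · -- level `j+1 → j+2`: the transports of the trivial averaged field are `1`
    have h1 : emlIterU (j + 1) (bgUnits F K U₀) = fun _ => 1 := htriv (j + 1) (Nat.succ_pos j)
    simp only [Nat.succ_ne_zero, if_false, h1, holT_one, inv_one, Units.val_one, one_mul, mul_one, sub_self]
    rw [h0, map_zero, sub_zero]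

/-- ★★★ **THE CONSTANT PARAMETER LIES IN THE RESIDUAL GAUGE ALGEBRA OF A ONE-BLOCK-PERIODIC BACKGROUND WITH TRIVIAL AVERAGED TOWER.**  For
`U₀ ∈ 𝔘_k(ε₀)` (`RegPr`, `10¹²L³ε₀ ≤ 1`) with block-independent centre-based level-0 transports (`hper`, e.g. §1) and `Ū₀ʲ = emlIterU j U₀♭ ≡ 1` for
`1 ≤ j` (`htriv`), and `n < K` (at least one averaging step): `toL2S (fun _ => c) ∈ N_S(U₀)` for EVERY `c ∈ M₂(ℂ)` — by
✓`mem_NS_of_topMean_parallel` on the explicit sequence of `avgSeq_const_succ`, whose top mean is the constant `c₁`, trivially `Ū₀ ≡ 1`-parallel.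
[cite: Balaban1985BackgroundPropagators, (3.19) p.393, (3.21) p.394, (3.115) p.418] -/
theorem toL2S_const_mem_NS (h : n ≤ K) {c₀ : ℝ} [Fact (0 < c₀)] (cB : ℝ) {ε₀ : ℝ} (hε₀ : 0 < ε₀) (hWε : 10 ^ 12 * (F.L : ℝ) ^ 3 * ε₀ ≤ 1)
    (U₀ : GaugeField (F.P K) 0 (Matrix.specialUnitaryGroup (Fin 2) ℂ)) (hreg : RegPr F n K ε₀ U₀) (y₀ : Site (F.P K) 1)
    (hper : ∀ (y : Site (F.P K) 1) (w : List (B7Prop1Explicit.Letter (F.P K).d)), holT (bgUnits F K U₀) (emb y) w = holT (bgUnits F K U₀) (emb y₀) w)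
    (htriv : ∀ j : ℕ, 1 ≤ j → emlIterU j (bgUnits F K U₀) = fun _ => 1) (hnK : n < K) (c : Matrix (Fin 2) (Fin 2) ℂ) :
    toL2S F K c₀ (fun _ => c) ∈ NS F n K h c₀ cB U₀ := by
  refine mem_NS_of_topMean_parallel F h cB hε₀ hWε U₀ hreg
    (fun (j : ℕ) (_ : Site (F.P K) j) => if j = 0 then c else
        c - meanCLM (Idx (F.P K)) (Matrix (Fin 2) (Fin 2) ℂ) fun i : Idx (F.P K) =>
          c - ((holT (bgUnits F K U₀) (emb y₀) (stairWord i.2.1 (off i.1)) : (Matrix (Fin 2) (Fin 2) ℂ)ˣ) : Matrix (Fin 2) (Fin 2) ℂ) * c *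
            (((holT (bgUnits F K U₀) (emb y₀) (stairWord i.2.1 (off i.1)))⁻¹ : (Matrix (Fin 2) (Fin 2) ℂ)ˣ) : Matrix (Fin 2) (Fin 2) ℂ))
    (fun _ => c) (by funext x; simp only [if_true]) (avgSeq_const_succ F U₀ y₀ hper htriv c) ?_
  intro e
  have hk : K - n ≠ 0 := by omega
  have h1 : emlIterU (K - n) (bgUnits F K U₀) = fun _ => 1 := htriv (K - n) (by omega)
  simp only [hk, if_false, h1, one_conjR]

end Member

/-! ## §3 The covariant gradient of the constant parameter -/

section Gradient

variable (F : T3Family) {n K : ℕ}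

/-- `‖U c U⁻¹ − c‖ ≤ 2·‖U − 1‖·‖c‖` at a bond of an `SU(2)` background read in the units of `M₂(ℂ)` (`U⁻¹ = U*`, `‖U‖ = ‖U*‖ = 1`;
✓`norm_conjR_sub_conjR_le` at the pair `(U, 1)`). [cite: Balaban1985Averaging, (19) p.21] -/
theorem norm_conjR_bgUnits_sub_le (U₀ : GaugeField (F.P K) 0 (Matrix.specialUnitaryGroup (Fin 2) ℂ)) (b : PBond (F.P K) 0) (c : Matrix (Fin 2) (Fin 2) ℂ) :
    ‖conjR (bgUnits F K U₀ b) c - c‖ ≤ 2 * ‖((U₀ b : Matrix.specialUnitaryGroup (Fin 2) ℂ) : Matrix (Fin 2) (Fin 2) ℂ) - 1‖ * ‖c‖ := by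
  have hU : bgUnits F K U₀ b ∈ U1 (Matrix (Fin 2) (Fin 2) ℂ) := unitsField_toUField_mem_U1' U₀ b
  have h := norm_conjR_sub_conjR_le hU (U1 (Matrix (Fin 2) (Fin 2) ℂ)).one_mem c
  rw [one_conjR, Units.val_one] at h
  exact h

/-- ★★ **THE COVARIANT GRADIENT OF THE CONSTANT PARAMETER, BONDWISE**: `‖((toL2)⁻¹(D_{U₀}(toL2S c))) b‖ ≤ 2·‖U₀(b) − 1‖·L^{K−n}·‖c‖`
(★px20 ✓`toL2_symm_DL2_toL2S_eq`: the stencil is `η⁻¹·(U₀(b) c U₀(b)⁻¹ − c)`, `η = L^{−(K−n)}`). [cite: Balaban1985BackgroundPropagators, (3.3) p.391] -/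
theorem norm_toL2_symm_DL2_toL2S_const_le {c₀ : ℝ} [Fact (0 < c₀)] (U₀ : GaugeField (F.P K) 0 (Matrix.specialUnitaryGroup (Fin 2) ℂ))
    (c : Matrix (Fin 2) (Fin 2) ℂ) (b : PBond (F.P K) 0) :
    ‖(toL2 F K c₀).symm (DL2 F n K c₀ U₀ (toL2S F K c₀ fun _ => c)) b‖ ≤
      2 * ‖((U₀ b : Matrix.specialUnitaryGroup (Fin 2) ℂ) : Matrix (Fin 2) (Fin 2) ℂ) - 1‖ * (F.L : ℝ) ^ (K - n) * ‖c‖ := by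
  rw [toL2_symm_DL2_toL2S_eq]
  dsimp only
  have hη : 0 < eta F n K := eta_pos F n K
  have hηinv : (eta F n K)⁻¹ = (F.L : ℝ) ^ (K - n) := by
    unfold eta; rw [inv_pow, inv_inv]
  rw [norm_smul, norm_inv, Complex.norm_real, Real.norm_of_nonneg hη.le, hηinv]
  have h := norm_conjR_bgUnits_sub_le F U₀ b c
  have hL : (0 : ℝ) ≤ (F.L : ℝ) ^ (K - n) := by positivity
  calc (F.L : ℝ) ^ (K - n) * ‖conjR (bgUnits F K U₀ b) c - c‖
      ≤ (F.L : ℝ) ^ (K - n) * (2 * ‖((U₀ b : Matrix.specialUnitaryGroup (Fin 2) ℂ) : Matrix (Fin 2) (Fin 2) ℂ) - 1‖ * ‖c‖) :=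
        mul_le_mul_of_nonneg_left h hL
    _ = 2 * ‖((U₀ b : Matrix.specialUnitaryGroup (Fin 2) ℂ) : Matrix (Fin 2) (Fin 2) ℂ) - 1‖ * (F.L : ℝ) ^ (K - n) * ‖c‖ := by ring

/-- ★★★ **THE LOW MODE IS THE CONSTANT** — the three rows of px12 g11's SPEC-0 `spec_lowMode` for `lam := fun _ => c` at a background with
block-independent centre-based transports, trivial averaged tower from level 1, `U₀ ∈ 𝔘_k(ε₀)`, `10¹²L³ε₀ ≤ 1`, `n < K`, and the bond window
`‖U₀(b) − 1‖ ≤ δ`: membership in `N_S(U₀)`, pointwise distance `0` to `c` (`C₁ = 0`), and covariant gradient `≤ 2δ·L^{K−n}·‖c‖` (`C₂ = 2δ`).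
[cite: Balaban1985BackgroundPropagators, (3.19) p.393, (3.3) p.391] -/
theorem lowMode_const (h : n ≤ K) {c₀ : ℝ} [Fact (0 < c₀)] (cB : ℝ) {ε₀ : ℝ} (hε₀ : 0 < ε₀) (hWε : 10 ^ 12 * (F.L : ℝ) ^ 3 * ε₀ ≤ 1)
    (U₀ : GaugeField (F.P K) 0 (Matrix.specialUnitaryGroup (Fin 2) ℂ)) (hreg : RegPr F n K ε₀ U₀) (y₀ : Site (F.P K) 1)
    (hper : ∀ (y : Site (F.P K) 1) (w : List (B7Prop1Explicit.Letter (F.P K).d)), holT (bgUnits F K U₀) (emb y) w = holT (bgUnits F K U₀) (emb y₀) w)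
    (htriv : ∀ j : ℕ, 1 ≤ j → emlIterU j (bgUnits F K U₀) = fun _ => 1) (hnK : n < K) {δ : ℝ}
    (hδ : ∀ b : PBond (F.P K) 0, ‖((U₀ b : Matrix.specialUnitaryGroup (Fin 2) ℂ) : Matrix (Fin 2) (Fin 2) ℂ) - 1‖ ≤ δ) (c : Matrix (Fin 2) (Fin 2) ℂ) :
    toL2S F K c₀ (fun _ => c) ∈ NS F n K h c₀ cB U₀ ∧
      (∀ x : Site (F.P K) 0, ‖(fun _ : Site (F.P K) 0 => c) x - c‖ ≤ 0 * ‖c‖) ∧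
      (∀ b : PBond (F.P K) 0, ‖(toL2 F K c₀).symm (DL2 F n K c₀ U₀ (toL2S F K c₀ fun _ => c)) b‖ ≤ 2 * δ * (F.L : ℝ) ^ (K - n) * ‖c‖) := by
  refine ⟨toL2S_const_mem_NS F h cB hε₀ hWε U₀ hreg y₀ hper htriv hnK c, fun x => by simp, fun b => ?_⟩
  refine (norm_toL2_symm_DL2_toL2S_const_le F U₀ c b).trans ?_
  have hL : (0 : ℝ) ≤ (F.L : ℝ) ^ (K - n) * ‖c‖ := by positivity
  nlinarith [hδ b, hL, norm_nonneg c]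

end Gradient

end Summit.QuantumFields.YangMills.Theorems.Prop7HPcolNegConstantMode

end
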